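import Mathlib
import HarnessLib
import Literature.RingTheory.CohomologyAnnihilator.Basic
import Summits.ResolutionOfSingularities.ResolutionOfSingularities.Theorems.HomologicalConductorPersistenceSurfaceSaturationResidual
import Summits.ResolutionOfSingularities.ResolutionOfSingularities.Theorems.HomologicalConductorPersistenceQuotientHypersurfaceSaturation

/-!
# Rung S-2 `PersistenceSurface` — the Sat₄ residual cut, SECOND CUT (abstract hypersurface stages)

Route `ResolutionOfSingularities/HomologicalConductor`, chain W4.4b, rung S-2 `PersistenceSurface`
(stmt-ResolutionOfSingularities-19970); o9/o11 lineage.  [OURS · L1 w44b · res-type-011; AI-written,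
weaker than expert review; NOT a statement of the manuscript under study, and no statement of that
manuscript is used.]

o11 (`PersistenceSurfaceSaturationResidual`, p511663) cut the `Sat₄` obligation down to the stages that
are neither regular nor PRESENTED monic-hypersurface localisations over `k[x,y]`.  With o9f
(`QuotientHypersurfaceSaturation`: `ca(R ⧸ (f)) = caᵈ⁺¹(R ⧸ (f))` for `R` regular local of dimension
`d + 1`, `f` a nonzerodivisor — no power basis, no monicity, no `k`-rationality) the cut sharpens to the
stages that are not ABSTRACT HYPERSURFACES either, i.e. (for normal surface stages) embedding dimension
`≥ 4`:

* `IsRegularHypersurfaceQuotient d T` — `T ≃+* R ⧸ (f)` for SOME regular local ring `R` of dimension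
  `d + 1` and nonzerodivisor `f`;
* `cohomologyAnnihilator_eq_of_isRegularHypersurfaceQuotient` — then `ca(T) = caᵈ⁺¹(T)`;
  `ca_subset_caAt_of_isRegularHypersurfaceQuotient` — route vocabulary, `ca T ⊆ caAt n T` (`n ≥ d + 1`);
* `@[conjecture] SaturationFourSurfaceResidual₂` — o3's binders VERBATIM; conclusion only at stages that
  are NOT regular, NOT presented monic-hypersurface localisations, and NOT abstract hypersurface quotients
  of a regular local ring of dimension `3`;
* `saturationFourSurfaceResidual_of_residual₂ : SaturationFourSurfaceResidual₂ → SaturationFourSurfaceResidual`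
  (so every o11 consequence follows: `saturationFourSurface_of_residual₂`,
  `persistenceSurface_of_residual₂_of_levelFour`).
-/

noncomputable section

-- single-problem summit: the doubled namespace component `ResolutionOfSingularities` is forced
set_option linter.dupNamespace false

namespace Summit.ResolutionOfSingularities.ResolutionOfSingularities.Theorems.HomologicalConductor.PersistenceSurfaceSaturationResidualTwo

open CategoryTheory CategoryTheory.Abelian Literature.RingTheory.CohomologyAnnihilator
open scoped nonZeroDivisors
open Summit.ResolutionOfSingularities.ResolutionOfSingularities.Theorems.NoZeno.Birth
open Summit.ResolutionOfSingularities.ResolutionOfSingularities.Theorems.HomologicalConductor.PersistenceSurfaceLevelFour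
open Summit.ResolutionOfSingularities.ResolutionOfSingularities.Theorems.HomologicalConductor.PeriodicSaturationStage
open Summit.ResolutionOfSingularities.ResolutionOfSingularities.Theorems.HomologicalConductor.PersistenceSurfaceSaturationResidual
open Summit.ResolutionOfSingularities.ResolutionOfSingularities.Theorems.HomologicalConductor.QuotientHypersurfaceSaturation

/-- **`IsRegularHypersurfaceQuotient d T`** [this work]: `T` is PRESENTED as an abstract hypersurface
`R ⧸ (f)` with `R` a regular local ring of Krull dimension `d + 1` and `f` a nonzerodivisor of `R`
(any `f ≠ 0`, `R` being a domain). NOT a statement of the manuscript. -/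
def IsRegularHypersurfaceQuotient (d : ℕ) (T : Type) [CommRing T] : Prop :=
  ∃ (R : Type) (_ : CommRing R) (_ : IsRegularLocalRing R), ringKrullDim R = (d + 1 : ℕ) ∧
    ∃ f : R, f ∈ nonZeroDivisors R ∧ Nonempty (T ≃+* R ⧸ Ideal.span {f})

/-- `ca(T) = caᵈ⁺¹(T)` for every abstract hypersurface quotient of a regular local ring of dimension
`d + 1` (o9f `cohomologyAnnihilator_quotient_eq_of_isRegularLocalRing`, transported). [OURS] -/
theorem cohomologyAnnihilator_eq_of_isRegularHypersurfaceQuotient {d : ℕ} {T : Type} [CommRing T]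
    (h : IsRegularHypersurfaceQuotient d T) :
    cohomologyAnnihilator T = cohomologyAnnihilatorOfDegree T (d + 1) := by
  obtain ⟨R, _, _, hd, f, hf, ⟨e⟩⟩ := h
  exact cohomologyAnnihilator_eq_of_ringEquiv e
    (cohomologyAnnihilator_quotient_eq_of_isRegularLocalRing hd f hf)

variable {k K : Type} [Field k] [Field K] [Algebra k K]

/-- **`Satₙ` at an abstract hypersurface stage** (route vocabulary): for a subalgebra stage `T ⊆ K`
with `IsRegularHypersurfaceQuotient d ↥T`, the route's `ca T ⊆ caAt n T` for every `n ≥ d + 1`. [OURS] -/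
theorem ca_subset_caAt_of_isRegularHypersurfaceQuotient (T : Subalgebra k K) {d n : ℕ}
    (h : IsRegularHypersurfaceQuotient d ↥T) (hn : d + 1 ≤ n) :
    {x : K | ∃ hx : x ∈ T, ∃ m : ℕ, ∀ i : ℕ, m ≤ i → ∀ (M N : ModuleCat.{0} ↥T),
        Module.Finite ↥T M → Module.Finite ↥T N →
          ∀ e : CategoryTheory.Abelian.Ext.{0} M N i, (⟨x, hx⟩ : ↥T) • e = 0} ⊆
      {x : K | ∃ hx : x ∈ T, ∀ i : ℕ, n ≤ i → ∀ (M N : ModuleCat.{0} ↥T),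
        Module.Finite ↥T M → Module.Finite ↥T N →
          ∀ e : CategoryTheory.Abelian.Ext.{0} M N i, (⟨x, hx⟩ : ↥T) • e = 0} :=
  ca_subset_caAt_of_le T
    ((cohomologyAnnihilator_eq_of_isRegularHypersurfaceQuotient h).le.trans
      (cohomologyAnnihilatorOfDegree_mono hn))

/-- **`SaturationFourSurfaceResidual₂` (OURS · second cut)** — o3's `SaturationFourSurface` (binders
VERBATIM) with the conclusion restricted to the stages that are NEITHER regular, NOR presented
monic-hypersurface localisations over `k[x,y]` (o11), NOR abstract hypersurface quotients `R ⧸ (f)` of a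
regular local ring `R` of dimension `3` (o9f): for normal surface stages this is «embedding dimension
`≥ 4`» (plus stages not yet presented). NOT a statement of the manuscript. [this work] -/
@[conjecture]
def SaturationFourSurfaceResidual₂ : Prop :=
  ∀ p : ℕ, p.Prime → ∀ (k K : Type) [Field k] [CharP k p] [Field K] [Algebra k K] (O : ValuationSubring K) (A : Subalgebra k K), (∀ c : k, algebraMap k K c ∈ O) → A.FG → IsFractionRing ↥A K → A.toSubring ≤ O.toSubring → ringKrullDim ↥A ≤ 2 → let caAt : ℕ → Subalgebra k K → Set K := fun n A => {x : K | ∃ hx : x ∈ A, ∀ i : ℕ, n ≤ i → ∀ (M N : ModuleCat.{0} ↥A), Module.Finite ↥A M → Module.Finite ↥A N → ∀ e : CategoryTheory.Abelian.Ext.{0} M N i, (⟨x, hx⟩ : ↥A) • e = 0}; let ca : Subalgebra k K → Set K := fun A => {x : K | ∃ hx : x ∈ A, ∃ n : ℕ, ∀ i : ℕ, n ≤ i → ∀ (M N : ModuleCat.{0} ↥A), Module.Finite ↥A M → Module.Finite ↥A N → ∀ e : CategoryTheory.Abelian.Ext.{0} M N i, (⟨x, hx⟩ : ↥A) • e = 0};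 let loc : Subalgebra k K → Subalgebra k K := fun A => Algebra.adjoin k {y : K | ∃ a ∈ A, ∃ s ∈ A, s⁻¹ ∈ O ∧ y = a * s⁻¹}; let chart : Subalgebra k K → Subalgebra k K := fun A => Algebra.adjoin k ((A : Set K) ∪ {y : K | ∃ c ∈ ca A, ∃ x ∈ ca A, x ≠ 0 ∧ (∀ c' ∈ ca A, c' * x⁻¹ ∈ O) ∧ y = c * x⁻¹}); let nrm : Subalgebra k K → Subalgebra k K := fun B => Algebra.adjoin k {y : K | IsIntegral ↥B y}; let tower : Subalgebra k K → ℕ → Subalgebra k K := fun A m => @Nat.rec (fun _ => Subalgebra k K) (loc A) (fun _ B => loc (nrm (chart B))) m; ∀ m : ℕ, ¬ IsRegularLocalRing ↥(tower A m) → ¬ IsMonicHypersurfaceLocalization k 2 ↥(tower A m) → ¬ IsRegularHypersurfaceQuotient 2 ↥(tower A m) → ca (tower A m) ⊆ caAt 4 (tower A m)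

/-- **The second cut**: `SaturationFourSurfaceResidual₂ → SaturationFourSurfaceResidual` (at an abstract
hypersurface stage o9f discharges the clause by name). [OURS] -/
theorem saturationFourSurfaceResidual_of_residual₂ (h : SaturationFourSurfaceResidual₂) :
    SaturationFourSurfaceResidual := by
  intro p hp k K _ _ _ _ O A hk hA hfr hAO hdim caAt ca loc chart nrm tower m hreg hmon x hx
  by_cases hab : IsRegularHypersurfaceQuotient 2 ↥(NoZeno.Birth.tower O A m)
  · exact ca_subset_caAt_of_isRegularHypersurfaceQuotient (NoZeno.Birth.tower O A m) hab
      (by norm_num) hx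
  · exact h p hp k K O A hk hA hfr hAO hdim m hreg hmon hab hx

/-- `SaturationFourSurface` from the second residual. [OURS] -/
theorem saturationFourSurface_of_residual₂ (h : SaturationFourSurfaceResidual₂) :
    SaturationFourSurface :=
  saturationFourSurface_of_residual (saturationFourSurfaceResidual_of_residual₂ h)

/-- The rung from the second residual and `L₄`. [OURS] -/
theorem persistenceSurface_of_residual₂_of_levelFour (hS : SaturationFourSurfaceResidual₂)
    (hL : LevelFourPersistenceSurface) :
    Summit.ResolutionOfSingularities.ResolutionOfSingularities.Theses.HomologicalConductor.PersistenceSurface :=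
  persistenceSurface_of_residual_of_levelFour (saturationFourSurfaceResidual_of_residual₂ hS) hL

end Summit.ResolutionOfSingularities.ResolutionOfSingularities.Theorems.HomologicalConductor.PersistenceSurfaceSaturationResidualTwo

end
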